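import Literature.NumberTheory.LFunctions.ModifiedGRHLOneLowerBounds
import Literature.NumberTheory.LFunctions.RHWave0
import HarnessLib

/-!
# GRH implies Sarnak–Zaharescu's Hypothesis H (the "modified GRH") for Dirichlet `L`-functions

Topic `Literature/NumberTheory/LFunctions` (namespace `Literature.NumberTheory.LFunctions`).
PROVED bookkeeping for the cell `parity-realchar` (SIEGEL INSTRUMENT, conditionals column, exit II.5):
the literal Hypothesis H of `ModifiedGRHLOneLowerBounds.lean` — every zero of `L(s, χ)`, `χ` real
primitive, is real or on `Re s = 1/2` (`ModifiedGRH`, typed with NO strip restriction) — follows from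
the tree's open-strip `GeneralizedRiemannHypothesis` (`RHWave0.lean`: every zero with `0 < Re s < 1`
has `Re s = 1/2`, all characters, all moduli). "Hypothesis H is of course a weak form of GRH"
[cite: SarnakZaharescu2002, Comment (C1) p. 496]; the content here is the boundary bookkeeping
that the literal form requires and the strip form avoids:

* `Re s ≥ 1`: `L(s, χ) ≠ 0` unless `χ = 1 ∧ s = 1` (Mathlib
  `DirichletCharacter.LFunction_ne_zero_of_one_le_re`), and `s = 1` is real;
* `Re s ≤ 0`, `Im s ≠ 0`: impossible for PRIMITIVE `χ` — the Archimedean factor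
  `gammaFactor χ s ∈ {Γ_ℝ(s), Γ_ℝ(s+1)}` vanishes only at non-positive EVEN/ODD integers (Mathlib
  `Complex.Gammaℝ_eq_zero_iff`), so `Λ(s, χ) = 0`; the functional equation (Mathlib
  `DirichletCharacter.IsPrimitive.completedLFunction_one_sub`, with `χ⁻¹ = χ` for quadratic `χ`)
  gives `Λ(1 − s, χ) = N^{s−1/2} ε(χ) Λ(s, χ) = 0`, hence `L(1 − s, χ) = 0` with `Re(1 − s) ≥ 1`,
  `1 − s ≠ 1` — contradicting the non-vanishing on `Re ≥ 1`. (For `N = 1`, `ζ`, the same argument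
  runs with Mathlib's `completedRiemannZeta` case of the functional equation; no appeal to the
  trivial-zero classification is needed.)

Consequences recorded: under GRH, Theorem 1 of Sarnak–Zaharescu applies (`…_of_generalizedRiemannHypothesis`
corollaries of the `ModifiedGRH.*` readings). No new named fact; nothing about the truth of GRH.
-/

noncomputable section

open scoped Classical
open Complex

namespace Literature.NumberTheory.LFunctions

open SarnakZaharescu2002

/-- **A primitive Dirichlet `L`-function has no non-real zeros in the closed left half-plane**
(`Re s ≤ 0`, `Im s ≠ 0` ⇒ `L(s, χ) ≠ 0`): by the functional equation such a zero would give a zero of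
`L(1 − s, χ⁻¹)` with `Re(1 − s) ≥ 1` off the real axis. Stated for quadratic `χ` (so `χ⁻¹ = χ`),
which is all this file needs. [cite: MontgomeryVaughan2007, Corollary 10.8] -/
theorem LFunction_ne_zero_of_re_nonpos_of_im_ne_zero {q : ℕ} [NeZero q]
    {χ : DirichletCharacter ℂ q} (hprim : χ.IsPrimitive) (hquad : χ.IsQuadratic) {s : ℂ}
    (hre : s.re ≤ 0) (him : s.im ≠ 0) : χ.LFunction s ≠ 0 := by
  intro hL
  -- the Archimedean factor does not vanish off the real axis
  have hΓ : DirichletCharacter.gammaFactor χ s ≠ 0 := by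
    rcases χ.even_or_odd with hev | hodd
    · rw [hev.gammaFactor_def, Ne, Complex.Gammaℝ_eq_zero_iff, not_exists]
      intro n hn
      apply him
      rw [hn]
      simp
    · rw [hodd.gammaFactor_def, Ne, Complex.Gammaℝ_eq_zero_iff, not_exists]
      intro n hn
      apply him
      have : s = -(2 * (n : ℂ)) - 1 := by linear_combination hn
      rw [this]
      simp
  have hs0 : s ≠ 0 := by
    intro h; apply him; rw [h]; simp
  -- so the completed `L`-function vanishes at `s`
  have hΛ : DirichletCharacter.completedLFunction χ s = 0 := by
    have h := DirichletCharacter.LFunction_eq_completed_div_gammaFactor χ s (Or.inl hs0)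
    rw [hL, eq_comm, div_eq_zero_iff] at h
    exact h.resolve_right hΓ
  -- functional equation: `Λ(χ, 1 − s) = N^{s − 1/2} ε Λ(χ⁻¹, s) = 0`
  have hΛ' : DirichletCharacter.completedLFunction χ (1 - s) = 0 := by
    rw [hprim.completedLFunction_one_sub s, hquad.inv, hΛ, mul_zero]
  -- hence `L(χ, 1 − s) = 0`, contradicting non-vanishing on `Re ≥ 1`
  have h1s0 : 1 - s ≠ 0 := by
    intro h; apply him
    have : s = 1 := by linear_combination -h
    rw [this]; simp
  have hL' : χ.LFunction (1 - s) = 0 := by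
    rw [DirichletCharacter.LFunction_eq_completed_div_gammaFactor χ (1 - s) (Or.inl h1s0), hΛ',
      zero_div]
  have hne1 : (1 : ℂ) - s ≠ 1 := by
    intro h; apply him
    have : s = 0 := by linear_combination -h
    rw [this]; simp
  have hre' : 1 ≤ (1 - s).re := by simp; linarith
  exact DirichletCharacter.LFunction_ne_zero_of_one_le_re χ (Or.inr hne1) hre' hL'

/-- **GRH (open-strip form, tree `GeneralizedRiemannHypothesis`) implies Hypothesis H
(`ModifiedGRH`, literal form).** [cite: SarnakZaharescu2002, Comment (C1) p. 496] -/
theorem ModifiedGRH.of_generalizedRiemannHypothesis (hGRH : GeneralizedRiemannHypothesis) :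
    ModifiedGRH := by
  intro q _ χ hquad hprim s hL
  by_cases him : s.im = 0
  · exact Or.inl him
  right
  rcases lt_or_ge 0 s.re with hpos | hnonpos
  · rcases lt_or_ge s.re 1 with hlt1 | hge1
    · exact hGRH q χ s hL hpos hlt1
    · -- `Re s ≥ 1`, `Im s ≠ 0`: no zero there
      have hs1 : s ≠ 1 := by
        intro h; apply him; rw [h]; simp
      exact absurd hL (DirichletCharacter.LFunction_ne_zero_of_one_le_re χ (Or.inr hs1) hge1)
  · exact absurd hL (LFunction_ne_zero_of_re_nonpos_of_im_ne_zero hprim hquad hnonpos him)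

/-- Under GRH and Sarnak–Zaharescu's Theorem 1 there are no exceptional characters of any strength
`A > 0` (`ModifiedGRH.not_exceptionalCharactersOfStrength` with H supplied by GRH). (The tree also
proves stronger GRH consequences directly; this records the route through Hypothesis H.)
[cite: SarnakZaharescu2002, Theorem 1 (p. 497)] -/
theorem not_exceptionalCharactersOfStrength_of_generalizedRiemannHypothesis_of_theorem1
    (hGRH : GeneralizedRiemannHypothesis) (h1 : sarnakZaharescu2002_theorem1) {A : ℝ} (hA : 0 < A) :
    ¬ ExceptionalCharactersOfStrength A :=
  (ModifiedGRH.of_generalizedRiemannHypothesis hGRH).not_exceptionalCharactersOfStrength h1 hA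

/-- Under GRH and Sarnak–Zaharescu's Theorem 1, Friedlander–Iwaniec's `SmallEtaCharacters ε` fails
for every `ε`. [cite: SarnakZaharescu2002, Theorem 1 (p. 497)] -/
theorem not_smallEtaCharacters_of_generalizedRiemannHypothesis_of_theorem1
    (hGRH : GeneralizedRiemannHypothesis) (h1 : sarnakZaharescu2002_theorem1) (ε : ℝ) :
    ¬ SmallEtaCharacters ε :=
  (ModifiedGRH.of_generalizedRiemannHypothesis hGRH).not_smallEtaCharacters h1 ε

end Literature.NumberTheory.LFunctions

end
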